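import Summits.HodgeConjecture.CorCM.Census.OddSliceFacesSquares
import Summits.HodgeConjecture.CorCM.Census.QuarticInversionHodge

/-!
# The quartic inversion twists, III: coordinates, flips, the four slice marginals, and the rank-four faces

COR-CM (cell `pub-hodgecm2`, stage 2 of the Hodge ladder), count-neutral KERNEL COMBINATORICS by the binder seat b23 (gen 44; claim
QUARTIC-INVERSION, HOME/INBOX.md l.12829).  Part III of the lane `Census/QuarticInversion*`, on top of parts I–II (`…Model`, `…Hodge`), the
dicyclic lane's part I (`Census/DicyclicTwistModel.lean`) and seat b09's slice (`Census/OddSliceFacesModel.lean`, `Census/OddSliceFacesSquares.lean`: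
`faceVec`, `faceVec_mem`, `pairVec`, `δ`), all BY NAME.  Bookkeeping definitions with bodies + theorems; no `decide` table, no certificate, no named
fact, no geometry, no `sorry`.  `Interfaces.lean` (C1), every E term, B01, `Transposition/*`, `PortJoin/*` untouched.
HONEST FRAMING: `HC_CM` is NOT proved, here or anywhere in the tree; nothing here is a period, a count of record or a headline.

CONTENT.  The `4|B|` places of `G_ζ(B)` (pairs `{g, cg}`) are the pairs `p = (k, i)`: a coset `k ∈ {0,1,2,3}` (`H₀, yH₀, tH₀, tyH₀`) and an
element `i ∈ B`; a flip at `p` adds b09's unit label `δ i` to the `k`-th coordinate of a quadruple.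
* §1 **Coordinates and flips**: `coord k Θ`, `addAt k χ Θ` (add `χ` to the `k`-th coordinate), their algebra, and the four **slice marginals**
  `sliceMarg k = marg_{k mod 2} ∘ Marg_{k div 2}` with `sliceMarg k (n·e_Θ) = n·e_{coord k Θ}`; **`v ∈ hodge₄ ↔ ∀ k, sliceMarg k v ∈ hodge`**
  (`mem_hodge₄_iff_sliceMarg`) — a vector is Hodge iff all four slice marginals are b09's Hodge vectors.
* §2 **The rank-four faces** `faceVec₄ Θ p q = e_Θ + e_{Θ̄^{(p)}} + e_{Θ̄^{(q)}} + e_{Θ^{(pq)}}` (b09's sign convention: the singly flipped corners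
  conjugated) for two places `p ≠ q`; their slice marginals are b09's face class `faceVec φ i j` (both places in coordinate `k`), a sum of two pairs
  (one place in coordinate `k`) or twice a pair (none) (`sliceMarg_faceVec₄`), so **every face with `p ≠ q` is a Hodge vector** (`faceVec₄_mem`):
  coordinate faces (`p.1 = q.1`, `p.2 ≠ q.2`) and mixed faces (`p.1 ≠ q.1`, any positions).
Part IV (`…Motion`) moves places and faces along the three motions.  All [folklore] (Pohlmann [Pohlmann1968, Thm 1]).

## References
* [Pohlmann1968] H. Pohlmann, Algebraic cycles on abelian varieties of complex multiplication type, Ann. of Math. 88 (1968), Thm 1.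
* [Milne1999] J. S. Milne, Lefschetz motives and the Tate conjecture, Compositio Math. 117 (1999), Prop. 2.1, p. 54.
-/

namespace Summit.HodgeConjecture.CorCM.Census.QuarticInversion

open Finset
open Summit.HodgeConjecture.CorCM.Census.OddSliceFacesModel
open Summit.HodgeConjecture.CorCM.Census.OddSliceFacesSquares (faceVec faceVec_mem)
open Summit.HodgeConjecture.CorCM.Census.DicyclicTwist (Ty₂ twH marg₀ marg₁ marg₀_single marg₁_single hodge₂ mem_hodge₂_iff conj)

noncomputable section

/-! ## §1 Coordinates, flips and the four slice marginals -/

section Coordinates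

variable (A : Type) [AddCommGroup A] [DecidableEq A]

/-- A place of `G_ζ(B)`: a coset index `k ∈ {0,1,2,3}` and an element of `B`. [folklore] -/
abbrev Pl : Type := Fin 4 × A

/-- **The `k`-th coordinate** of a quadruple `((ψ₀, ψ₁), (ψ₂, ψ₃))`. [folklore] -/
def coord (k : Fin 4) (Θ : Ty₄ A) : Ty A := ![Θ.1.1, Θ.1.2, Θ.2.1, Θ.2.2] k

/-- **Add `χ` to the `k`-th coordinate.** [folklore] -/
def addAt (k : Fin 4) (χ : Ty A) (Θ : Ty₄ A) : Ty₄ A :=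
  ![((Θ.1.1 + χ, Θ.1.2), Θ.2), ((Θ.1.1, Θ.1.2 + χ), Θ.2), (Θ.1, (Θ.2.1 + χ, Θ.2.2)), (Θ.1, (Θ.2.1, Θ.2.2 + χ))] k

/-- The flip at the place `p = (k, i)`: add `δ i` to the `k`-th coordinate. [folklore] -/
def flipAt (p : Pl A) (Θ : Ty₄ A) : Ty₄ A := addAt A p.1 (δ A p.2) Θ

omit [DecidableEq A] [AddCommGroup A] in
/-- The four coordinates, explicitly. [folklore] -/
@[simp] theorem coord_zero (Θ : Ty₄ A) : coord A 0 Θ = Θ.1.1 := rfl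
omit [DecidableEq A] [AddCommGroup A] in
/-- The four coordinates, explicitly. [folklore] -/
@[simp] theorem coord_one (Θ : Ty₄ A) : coord A 1 Θ = Θ.1.2 := rfl
omit [DecidableEq A] [AddCommGroup A] in
/-- The four coordinates, explicitly. [folklore] -/
@[simp] theorem coord_two (Θ : Ty₄ A) : coord A 2 Θ = Θ.2.1 := rfl
omit [DecidableEq A] [AddCommGroup A] in
/-- The four coordinates, explicitly. [folklore] -/
@[simp] theorem coord_three (Θ : Ty₄ A) : coord A 3 Θ = Θ.2.2 := rfl

omit [DecidableEq A] [AddCommGroup A] in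
/-- `addAt`, explicitly. [folklore] -/
@[simp] theorem addAt_zero (χ : Ty A) (Θ : Ty₄ A) : addAt A 0 χ Θ = ((Θ.1.1 + χ, Θ.1.2), Θ.2) := rfl
omit [DecidableEq A] [AddCommGroup A] in
/-- `addAt`, explicitly. [folklore] -/
@[simp] theorem addAt_one (χ : Ty A) (Θ : Ty₄ A) : addAt A 1 χ Θ = ((Θ.1.1, Θ.1.2 + χ), Θ.2) := rfl
omit [DecidableEq A] [AddCommGroup A] in
/-- `addAt`, explicitly. [folklore] -/
@[simp] theorem addAt_two (χ : Ty A) (Θ : Ty₄ A) : addAt A 2 χ Θ = (Θ.1, (Θ.2.1 + χ, Θ.2.2)) := rfl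
omit [DecidableEq A] [AddCommGroup A] in
/-- `addAt`, explicitly. [folklore] -/
@[simp] theorem addAt_three (χ : Ty A) (Θ : Ty₄ A) : addAt A 3 χ Θ = (Θ.1, (Θ.2.1, Θ.2.2 + χ)) := rfl

omit [DecidableEq A] [AddCommGroup A] in
/-- A quadruple is determined by its four coordinates. [folklore] -/
theorem ext_coord {Θ Θ' : Ty₄ A} (h : ∀ k, coord A k Θ = coord A k Θ') : Θ = Θ' :=
  Prod.ext (Prod.ext (h 0) (h 1)) (Prod.ext (h 2) (h 3))

omit [DecidableEq A] [AddCommGroup A] in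
/-- **Coordinates of a flipped quadruple**: `coord k (addAt l χ Θ) = coord k Θ + [k = l]·χ`. [folklore] -/
theorem coord_addAt (k l : Fin 4) (χ : Ty A) (Θ : Ty₄ A) :
    coord A k (addAt A l χ Θ) = coord A k Θ + (if k = l then χ else 0) := by
  fin_cases k <;> fin_cases l <;> simp [coord, addAt]

omit [DecidableEq A] [AddCommGroup A] in
/-- Adding `0` changes nothing. [folklore] -/
@[simp] theorem addAt_zero_right (k : Fin 4) (Θ : Ty₄ A) : addAt A k 0 Θ = Θ := by
  refine ext_coord A fun l => ?_
  rw [coord_addAt]; simp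

omit [DecidableEq A] [AddCommGroup A] in
/-- Adding twice in one coordinate. [folklore] -/
theorem addAt_addAt_same (k : Fin 4) (χ χ' : Ty A) (Θ : Ty₄ A) : addAt A k χ (addAt A k χ' Θ) = addAt A k (χ' + χ) Θ := by
  refine ext_coord A fun l => ?_
  simp only [coord_addAt]
  split_ifs <;> simp [add_assoc]

omit [DecidableEq A] [AddCommGroup A] in
/-- Flips in any two coordinates commute. [folklore] -/
theorem addAt_comm (k l : Fin 4) (χ χ' : Ty A) (Θ : Ty₄ A) : addAt A k χ (addAt A l χ' Θ) = addAt A l χ' (addAt A k χ Θ) := by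
  refine ext_coord A fun j => ?_
  simp only [coord_addAt]
  split_ifs <;> simp [add_right_comm]

omit [DecidableEq A] [AddCommGroup A] in
/-- Coordinates of the conjugate. [folklore] -/
theorem coord_conj₄ (k : Fin 4) (Θ : Ty₄ A) : coord A k (conj₄ A Θ) = coord A k Θ + 1 := by
  fin_cases k <;> rfl

omit [DecidableEq A] [AddCommGroup A] in
/-- Conjugation commutes with flips. [folklore] -/
theorem conj₄_addAt (k : Fin 4) (χ : Ty A) (Θ : Ty₄ A) : conj₄ A (addAt A k χ Θ) = addAt A k χ (conj₄ A Θ) := by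
  refine ext_coord A fun l => ?_
  rw [coord_conj₄, coord_addAt, coord_addAt, coord_conj₄, add_right_comm]

omit [DecidableEq A] in
/-- Coordinates of the diagonal motion. [folklore] -/
theorem coord_twH₄ (k : Fin 4) (g : ZMod 2 × A) (Θ : Ty₄ A) : coord A k (twH₄ A g Θ) = tw A g (coord A k Θ) := by
  fin_cases k <;> rfl

end Coordinates

section Marginals

variable (A : Type) [AddCommGroup A] [Fintype A] [DecidableEq A]

/-- **The four slice marginals** `sliceMarg k : ℤ[Ty₄] → ℤ[Ty]`: `marg_{k mod 2} ∘ Marg_{k div 2}`. [folklore] -/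
def sliceMarg (k : Fin 4) : (Ty₄ A → ℤ) →ₗ[ℤ] (Ty A → ℤ) :=
  ![(marg₀ A).comp (Marg₀ A), (marg₁ A).comp (Marg₀ A), (marg₀ A).comp (Marg₁ A), (marg₁ A).comp (Marg₁ A)] k

omit [AddCommGroup A] in
/-- **`sliceMarg k (n·e_Θ) = n·e_{coord k Θ}`.** [folklore] -/
@[simp] theorem sliceMarg_single (k : Fin 4) (Θ : Ty₄ A) (n : ℤ) : sliceMarg A k (Pi.single Θ n) = Pi.single (coord A k Θ) n := by
  fin_cases k <;> simp [sliceMarg, coord]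

omit [AddCommGroup A] in
/-- **A vector is Hodge iff its four slice marginals are b09's Hodge vectors.** [cite: Pohlmann1968, Thm 1] -/
theorem mem_hodge₄_iff_sliceMarg (v : Ty₄ A → ℤ) : v ∈ hodge₄ A ↔ ∀ k, sliceMarg A k v ∈ hodge A := by
  rw [mem_hodge₄_iff, mem_hodge₂_iff, mem_hodge₂_iff]
  constructor
  · rintro ⟨⟨h0, h1⟩, h2, h3⟩ k
    fin_cases k
    · exact h0
    · exact h1
    · exact h2
    · exact h3
  · intro h
    exact ⟨⟨h 0, h 1⟩, h 2, h 3⟩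

/-! ## §2 The rank-four faces -/

/-- **The rank-four face** through `Θ` at the places `p, q` (b09's sign convention): `e_Θ + e_{Θ̄^{(p)}} + e_{Θ̄^{(q)}} + e_{Θ^{(pq)}}`. [folklore] -/
def faceVec₄ (Θ : Ty₄ A) (p q : Pl A) : Ty₄ A → ℤ :=
  Pi.single Θ 1 + Pi.single (conj₄ A (flipAt A p Θ)) 1 + Pi.single (conj₄ A (flipAt A q Θ)) 1 +
    Pi.single (flipAt A p (flipAt A q Θ)) 1

/-- The pattern of a face in one coordinate: `quad φ a b = e_φ + e_{φ+1+a} + e_{φ+1+b} + e_{φ+a+b}`. [folklore] -/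
def quad (φ a b : Ty A) : Ty A → ℤ :=
  Pi.single φ 1 + Pi.single (φ + 1 + a) 1 + Pi.single (φ + 1 + b) 1 + Pi.single (φ + a + b) 1

/-- The contribution of the place `p` to the coordinate `k`: `δ p.2` if `p.1 = k`, else `0`. [folklore] -/
def bump (k : Fin 4) (p : Pl A) : Ty A := if k = p.1 then δ A p.2 else 0

omit [Fintype A] [AddCommGroup A] in
/-- Coordinates of a flip. [folklore] -/
theorem coord_flipAt (k : Fin 4) (p : Pl A) (Θ : Ty₄ A) : coord A k (flipAt A p Θ) = coord A k Θ + bump A k p := by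
  rw [flipAt, coord_addAt, bump]

omit [AddCommGroup A] in
/-- **The slice marginals of a face**: `sliceMarg k (faceVec₄ Θ p q) = quad (coord k Θ) (bump k p) (bump k q)`. [folklore] -/
theorem sliceMarg_faceVec₄ (k : Fin 4) (Θ : Ty₄ A) (p q : Pl A) :
    sliceMarg A k (faceVec₄ A Θ p q) = quad A (coord A k Θ) (bump A k p) (bump A k q) := by
  simp only [faceVec₄, map_add, sliceMarg_single, coord_conj₄, coord_flipAt, quad]
  rw [add_right_comm (coord A k Θ) (bump A k p) 1, add_right_comm (coord A k Θ) (bump A k q) 1,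
    add_right_comm (coord A k Θ) (bump A k q) (bump A k p)]

omit [AddCommGroup A] [DecidableEq A] in
/-- `quad φ 0 0` is twice the pair through `φ`. [folklore] -/
theorem quad_zero_zero (φ : Ty A) : quad A φ 0 0 = pairVec A φ + pairVec A φ := by
  simp only [quad, add_zero, pairVec]; abel

omit [AddCommGroup A] [DecidableEq A] in
/-- `quad φ a 0` is a sum of two pairs. [folklore] -/
theorem quad_zero_right (φ a : Ty A) : quad A φ a 0 = pairVec A φ + pairVec A (φ + a) := by
  simp only [quad, add_zero, pairVec]
  rw [add_right_comm φ 1 a]; abel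

omit [AddCommGroup A] [DecidableEq A] in
/-- `quad φ 0 b` is a sum of two pairs. [folklore] -/
theorem quad_zero_left (φ b : Ty A) : quad A φ 0 b = pairVec A φ + pairVec A (φ + b) := by
  simp only [quad, add_zero, pairVec]
  rw [add_right_comm φ 1 b]; abel

omit [AddCommGroup A] in
/-- `quad φ (δ i) (δ j)` is b09's face class `(φ; i, j)`. [folklore] -/
theorem quad_delta_delta (φ : Ty A) (i j : A) : quad A φ (δ A i) (δ A j) = faceVec A φ i j := rfl

omit [AddCommGroup A] in
/-- **`quad φ (bump k p) (bump k q)` is a Hodge vector of the slice whenever `p ≠ q`.** [folklore] -/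
theorem quad_bump_mem (k : Fin 4) {p q : Pl A} (hpq : p ≠ q) (φ : Ty A) : quad A φ (bump A k p) (bump A k q) ∈ hodge A := by
  unfold bump
  by_cases hp : k = p.1 <;> by_cases hq : k = q.1
  · rw [if_pos hp, if_pos hq, quad_delta_delta]
    refine faceVec_mem A φ fun hij => hpq ?_
    exact Prod.ext (hp.symm.trans hq) hij
  · rw [if_pos hp, if_neg hq, quad_zero_right]
    exact (hodge A).add_mem (pairVec_mem A _) (pairVec_mem A _)
  · rw [if_neg hp, if_pos hq, quad_zero_left]
    exact (hodge A).add_mem (pairVec_mem A _) (pairVec_mem A _)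
  · rw [if_neg hp, if_neg hq, quad_zero_zero]
    exact (hodge A).add_mem (pairVec_mem A _) (pairVec_mem A _)

omit [AddCommGroup A] in
/-- **Every rank-four face is a Hodge vector** (`p ≠ q`: two distinct places — a coordinate face when `p.1 = q.1`, a mixed face otherwise).
[cite: Pohlmann1968, Thm 1] -/
theorem faceVec₄_mem (Θ : Ty₄ A) {p q : Pl A} (hpq : p ≠ q) : faceVec₄ A Θ p q ∈ hodge₄ A := by
  rw [mem_hodge₄_iff_sliceMarg]
  intro k
  rw [sliceMarg_faceVec₄]
  exact quad_bump_mem A k hpq _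

/-- The set of all rank-four faces of the model. [folklore] -/
def faceSet₄ : Set (Ty₄ A → ℤ) := {v | ∃ Θ p q, p ≠ q ∧ v = faceVec₄ A Θ p q}

omit [AddCommGroup A] in
/-- **The faces lie in the Hodge lattice.** [folklore] -/
theorem faceSet₄_subset : faceSet₄ A ⊆ hodge₄ A := by
  rintro _ ⟨Θ, p, q, hpq, rfl⟩
  exact faceVec₄_mem A Θ hpq

omit [AddCommGroup A] in
/-- Faces are symmetric in their two places. [folklore] -/
theorem faceVec₄_comm (Θ : Ty₄ A) (p q : Pl A) : faceVec₄ A Θ p q = faceVec₄ A Θ q p := by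
  unfold faceVec₄ flipAt
  rw [addAt_comm]
  abel

end Marginals

end

end Summit.HodgeConjecture.CorCM.Census.QuarticInversion
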